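import Mathlib
import Summits.Ventures.PercRepro2.Defs
import Summits.Ventures.PercRepro2.Graph
import Summits.Ventures.PercRepro2.NestedMaskBHK

/-!
# Three-copy forms and their weight-free level cores (blind cell PercRepro2, mine-1 g25;
`proofs/MINE1-J1.md` §30(d))

For a kernel `K` of THREE configurations the **three-copy form** is
`triForm p K = ∑_{x,y,z} weight p x · weight p y · weight p z · K x y z`.  The product weight of a
triple depends on the configurations only through the **level** `lev x y z e ∈ {0,1,2,3}` of every
edge — the number of copies in which `e` is open — so the form regroups as

  `triForm p K = ∑_ℓ levelWeight p ℓ · core K ℓ`,   `core K ℓ = ∑_{lev x y z = ℓ} K x y z`,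

with `levelWeight p ℓ = ∏_e p_e^{ℓ_e} (1 − p_e)^{3 − ℓ_e} ≥ 0`.  Hence a three-copy inequality holds
for EVERY weight vector as soon as all its weight-free level cores are nonnegative
(`triForm_nonneg_of_core`): the three-copy analogue of `disSum_nonneg_of_pinned`.

The instance of record is the **contraction–deletion centred BHK form** (candidate lemma «2′CDC»,
`conjectures/MINE-1.md` §38): with `Q = {l ↮ h}` and the mask `m` contracted in the FIRST copy only,

  `cdcKernel m x y z = 1_{Q^m}(x) 1_Q(y) 1_Q(z) (1[b ∈ C^m_l](x) − 1[b ∈ C_l](y)) (1[o ∈ C^m_l](x) − 1[o ∈ C_l](z))`,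

whose three-copy form is the cleared inequality
`P^m(Q,B,O) P(Q)² − P^m(Q,O) P(Q,B) P(Q) − P^m(Q,B) P(Q) P(Q,O) + P^m(Q) P(Q,B) P(Q,O) ≥ 0`
(`triForm_cdcKernel`), i.e. `E_{G/m}[(1_B − P(B|Q))(1_O − P(O|Q)) 1_Q] ≥ 0`.  `CDCCore` — every level
core of this kernel is nonnegative — is the weight-free statement (3CORE) of §30(d) (exhaustive census
0 negatives on 31,872 level assignments, control fails); `cdc_of_core` is the bridge: under `CDCCore`
the weighted inequality holds for every weight vector.  Nothing about `CDCCore` itself is proved here.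
-/

namespace Summit.Ventures.PercRepro2

namespace ThreeCopy

section Forms

variable {E : Type*} [Fintype E] [DecidableEq E] {R : Type*} [CommRing R]

/-- The three-copy form `∑_{x,y,z} weight p x · weight p y · weight p z · K x y z`. -/
def triForm (p : E → R) (K : Config E → Config E → Config E → R) : R :=
  ∑ x : Config E, ∑ y : Config E, ∑ z : Config E, weight p x * weight p y * weight p z * K x y z

omit [Fintype E] [DecidableEq E] in
/-- The level of an edge in a triple of configurations: the number of copies in which it is open. -/
def lev (x y z : Config E) (e : E) : Fin 4 :=
  ⟨(x e).toNat + (y e).toNat + (z e).toNat, by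
    cases x e <;> cases y e <;> cases z e <;> decide⟩

/-- The weight of a level assignment: `∏_e p_e^{ℓ_e} (1 − p_e)^{3 − ℓ_e}`. -/
def levelWeight (p : E → R) (ℓ : E → Fin 4) : R :=
  ∏ e, p e ^ (ℓ e : ℕ) * (1 - p e) ^ (3 - (ℓ e : ℕ))

/-- The weight-free level core: the kernel summed over the triples of the given level. -/
def core (K : Config E → Config E → Config E → R) (ℓ : E → Fin 4) : R :=
  ∑ x : Config E, ∑ y : Config E, ∑ z : Config E, if lev x y z = ℓ then K x y z else 0

omit [DecidableEq E] in
/-- The product weight of a triple is the weight of its level assignment. -/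
lemma weight_mul_weight_mul_weight (p : E → R) (x y z : Config E) :
    weight p x * weight p y * weight p z = levelWeight p (lev x y z) := by
  unfold weight levelWeight
  rw [← Finset.prod_mul_distrib, ← Finset.prod_mul_distrib]
  refine Finset.prod_congr rfl fun e _ => ?_
  simp only [lev]
  cases x e <;> cases y e <;> cases z e <;> simp [edgeFactor] <;> ring

/-- **Level regrouping**: `triForm p K = ∑_ℓ levelWeight p ℓ · core K ℓ`. -/
theorem triForm_eq_sum_core (p : E → R) (K : Config E → Config E → Config E → R) :
    triForm p K = ∑ ℓ : E → Fin 4, levelWeight p ℓ * core K ℓ := by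
  have h1 : ∀ x y z : Config E,
      (∑ ℓ : E → Fin 4, if lev x y z = ℓ then levelWeight p ℓ * K x y z else 0) =
        levelWeight p (lev x y z) * K x y z := by
    intro x y z
    rw [Finset.sum_ite_eq]
    simp
  have step1 : ∀ x : Config E,
      (∑ y : Config E, ∑ z : Config E, ∑ ℓ : E → Fin 4,
          if lev x y z = ℓ then levelWeight p ℓ * K x y z else 0) =
        ∑ ℓ : E → Fin 4, ∑ y : Config E, ∑ z : Config E,
          if lev x y z = ℓ then levelWeight p ℓ * K x y z else 0 := fun x =>
    (Finset.sum_congr rfl fun y _ => Finset.sum_comm).trans Finset.sum_comm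
  calc triForm p K
      = ∑ x : Config E, ∑ y : Config E, ∑ z : Config E, levelWeight p (lev x y z) * K x y z := by
        unfold triForm
        simp only [weight_mul_weight_mul_weight]
    _ = ∑ x : Config E, ∑ y : Config E, ∑ z : Config E, ∑ ℓ : E → Fin 4,
          if lev x y z = ℓ then levelWeight p ℓ * K x y z else 0 := by
        simp only [h1]
    _ = ∑ ℓ : E → Fin 4, ∑ x : Config E, ∑ y : Config E, ∑ z : Config E,
          if lev x y z = ℓ then levelWeight p ℓ * K x y z else 0 :=
        (Finset.sum_congr rfl fun x _ => step1 x).trans Finset.sum_comm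
    _ = ∑ ℓ : E → Fin 4, levelWeight p ℓ * core K ℓ := by
        unfold core
        simp only [Finset.mul_sum, mul_ite, mul_zero]

end Forms

section Order

variable {E : Type*} [Fintype E] [DecidableEq E] {R : Type*} [CommRing R] [LinearOrder R]
  [IsStrictOrderedRing R]

omit [DecidableEq E] in
/-- Level weights are nonnegative for weights in `[0, 1]`. -/
lemma levelWeight_nonneg {p : E → R} (hp : ∀ e, 0 ≤ p e ∧ p e ≤ 1) (ℓ : E → Fin 4) :
    0 ≤ levelWeight p ℓ :=
  Finset.prod_nonneg fun e _ =>
    mul_nonneg (pow_nonneg (hp e).1 _) (pow_nonneg (sub_nonneg.2 (hp e).2) _)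

/-- **Three-copy forms from their cores**: if every level core of `K` is nonnegative, the
three-copy form is nonnegative for every weight vector in `[0, 1]^E`. -/
theorem triForm_nonneg_of_core {p : E → R} (hp : ∀ e, 0 ≤ p e ∧ p e ≤ 1)
    {K : Config E → Config E → Config E → R} (hK : ∀ ℓ : E → Fin 4, 0 ≤ core K ℓ) :
    0 ≤ triForm p K := by
  rw [triForm_eq_sum_core]
  exact Finset.sum_nonneg fun ℓ _ => mul_nonneg (levelWeight_nonneg hp ℓ) (hK ℓ)

end Order

/-! ## The contraction–deletion centred BHK kernel (2′CDC) -/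

section CDC

variable {V : Type*} {E : Type*} [Fintype E] [DecidableEq E] {R : Type*} [CommRing R]

open NestedMask

/-- The 2′CDC kernel: the first copy `x` carries the mask `m` (contracted), the copies `y`, `z` are
unmasked; `1_{Q^m}(x) 1_Q(y) 1_Q(z) (1[b ∈ C^m_l](x) − 1[b ∈ C_l](y)) (1[o ∈ C^m_l](x) − 1[o ∈ C_l](z))`. -/
noncomputable def cdcKernel (ends : E → Sym2 V) (m : Finset V) (l h b o : V)
    (x y z : Config E) : R :=
  avoidInd ends m l h x * avoidInd ends ∅ l h y * avoidInd ends ∅ l h z *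
    (memInd ends m l b x - memInd ends ∅ l b y) * (memInd ends m l o x - memInd ends ∅ l o z)

/-- The avoidance `Q = {l ↮ h}` as a set, read with the mask `m`. -/
abbrev Qm (ends : E → Sym2 V) (m : Finset V) (l h : V) : Set (Config E) :=
  (mconnEvent ends m l h)ᶜ

/-- **The three-copy form of the 2′CDC kernel is the cleared centred inequality**
`P^m(Q,B,O) P(Q)² − P^m(Q,O) P(Q,B) P(Q) − P^m(Q,B) P(Q) P(Q,O) + P^m(Q) P(Q,B) P(Q,O)`. -/
theorem triForm_cdcKernel (p : E → R) (ends : E → Sym2 V) (m : Finset V) (l h b o : V) :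
    triForm p (cdcKernel ends m l h b o) =
      prob p (Qm ends m l h ∩ mconnEvent ends m l b ∩ mconnEvent ends m l o) *
          prob p (Qm ends ∅ l h) * prob p (Qm ends ∅ l h) -
        prob p (Qm ends m l h ∩ mconnEvent ends m l o) *
          prob p (Qm ends ∅ l h ∩ mconnEvent ends ∅ l b) * prob p (Qm ends ∅ l h) -
        prob p (Qm ends m l h ∩ mconnEvent ends m l b) * prob p (Qm ends ∅ l h) *
          prob p (Qm ends ∅ l h ∩ mconnEvent ends ∅ l o) +
        prob p (Qm ends m l h) * prob p (Qm ends ∅ l h ∩ mconnEvent ends ∅ l b) *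
          prob p (Qm ends ∅ l h ∩ mconnEvent ends ∅ l o) := by
  classical
  have h3 : ∀ A B C : Set (Config E), prob p A * prob p B * prob p C =
      ∑ x : Config E, ∑ y : Config E, ∑ z : Config E, weight p x * weight p y * weight p z *
        (A.indicator 1 x * B.indicator 1 y * C.indicator 1 z) := by
    intro A B C
    simp only [prob_eq_expect_indicator, expect]
    rw [Finset.sum_mul_sum, Finset.sum_mul_sum]
    simp only [Finset.sum_mul]
    refine Finset.sum_congr rfl fun x _ => ?_
    rw [Finset.sum_comm]
    refine Finset.sum_congr rfl fun y _ => Finset.sum_congr rfl fun z _ => ?_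
    ring
  simp only [h3, triForm, ← Finset.sum_sub_distrib, ← Finset.sum_add_distrib]
  refine Finset.sum_congr rfl fun x _ => Finset.sum_congr rfl fun y _ =>
    Finset.sum_congr rfl fun z _ => ?_
  simp only [cdcKernel, avoidInd, memInd, Qm, Set.inter_indicator_one, Pi.mul_apply]
  ring

/-- **(3CORE)** — the weight-free statement of record: every level core of the 2′CDC kernel is
nonnegative (for every mask and every choice of roots and marks); `proofs/MINE1-J1.md` §30(d). -/
def CDCCore (R : Type*) [CommRing R] [LinearOrder R] (ends : E → Sym2 V) : Prop :=
  ∀ (m : Finset V) (l h b o : V) (ℓ : E → Fin 4), (0 : R) ≤ core (cdcKernel ends m l h b o) ℓ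

end CDC

section Bridge

variable {V : Type*} {E : Type*} [Fintype E] [DecidableEq E] {R : Type*} [CommRing R]
  [LinearOrder R] [IsStrictOrderedRing R]

open NestedMask

/-- **The bridge**: under (3CORE) the contraction–deletion centred BHK inequality (2′CDC) holds for
every weight vector in `[0,1]^E`, every mask `m` and all roots / marks, in its cleared form. -/
theorem cdc_of_core (ends : E → Sym2 V) (hcore : CDCCore R ends) {p : E → R} (hp : ∀ e, 0 ≤ p e ∧ p e ≤ 1)
    (m : Finset V) (l h b o : V) :
    0 ≤ prob p (Qm ends m l h ∩ mconnEvent ends m l b ∩ mconnEvent ends m l o) *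
          prob p (Qm ends ∅ l h) * prob p (Qm ends ∅ l h) -
        prob p (Qm ends m l h ∩ mconnEvent ends m l o) *
          prob p (Qm ends ∅ l h ∩ mconnEvent ends ∅ l b) * prob p (Qm ends ∅ l h) -
        prob p (Qm ends m l h ∩ mconnEvent ends m l b) * prob p (Qm ends ∅ l h) *
          prob p (Qm ends ∅ l h ∩ mconnEvent ends ∅ l o) +
        prob p (Qm ends m l h) * prob p (Qm ends ∅ l h ∩ mconnEvent ends ∅ l b) *
          prob p (Qm ends ∅ l h ∩ mconnEvent ends ∅ l o) := by
  rw [← triForm_cdcKernel]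
  exact triForm_nonneg_of_core hp (hcore m l h b o)

end Bridge

end ThreeCopy

end Summit.Ventures.PercRepro2
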